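import Summits.AtomisticToContinuum.Crystallization.Theses.PalmUnimodularRigidity
import Summits.AtomisticToContinuum.Crystallization.Theorems.MinimiserShells.Negative.LoadBearing
import Summits.AtomisticToContinuum.Crystallization.Theorems.MinimiserShells.Negative.Rootedness
import Literature.Probability.Process.PointStationaryLaw
import Literature.Probability.PointProcesses.FiniteConfigurationEvents
import Literature.MathematicalPhysics.StatisticalMechanics.RootEnergy
import Literature.MathematicalPhysics.StatisticalMechanics.MuGSC

/-!
# Giry-measurability of the shell event (stub `stub_goodShellMeasurable`, S5)

Stub S5 of line `equilibrium-in-law-surgery` of crux `MinimiserShells` (stmt-AtomisticToContinuum-9225,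
route `PalmUnimodularRigidity`): there is a measurable set `B` of configurations
`μ : Measure ℝ³` (Giry σ-algebra) such that for every `δ > 0` and every rooted `δ`-hard-core
counting measure `μ`, `μ ∈ B ↔ GoodShell μ`.  The Palm density lemma (S6) runs its Mecke transport
with `1[μ ∉ B]`.

Proof.  `GoodShell (count|S)` only depends on the finite set `S ∩ 𝕎`, `𝕎 = {y ≠ 0, ‖y‖ ≤ 5/4}`
the shell window (`goodShell_count_restrict_inter_window`), and `μ ↦ μ|𝕎` is measurable.  By the
transfer theorem `Literature.Probability.PointProcesses.exists_measurableSet_count_restrict_mem_iff`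
(countable read-out + sorted enumerations + Lusin–Souslin) it suffices that, for every `m`, the
good-shell condition on injective `m`-tuples of window points is Borel in `Fin m → ℝ³`
(`exists_measurableSet_goodShell`).  It is a countable union of CLOSED sets: the combinatorial
data of a matching are discretised — an injective assignment `g : pat → Fin m` of shell atoms to
the points of the pattern `pat ∈ {fcc, hcp}` and a gap parameter `k` turning the strict
inequality `‖y i‖ > 5a/4` for unmatched atoms into `≥ 5a/4 + 1/(k+1)` (`shell_iff_match`) — and
the continuous parameters `(a, L)` (scale `a ∈ [9/10, 1]`, linear isometry `L`, a compact set of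
continuous linear maps, `isCompact_iso`) are projected out along a compact factor
(`isClosed_setOf_exists_mem_of_isCompact`).  No definitions are introduced.
-/

noncomputable section

open MeasureTheory
open scoped ENNReal BigOperators

namespace Summit.AtomisticToContinuum.Crystallization.Theorems.PalmUnimodularRigidityMinimiserShells.GoodShellMeasurable

open Literature.Probability.Process (IsPointStationaryLaw IsRootedHardCore count_restrict_singleton_ne_zero_iff
  map_sub_count_restrict)
open Literature.Probability.PointProcesses (exists_measurableSet_count_restrict_mem_iff)
open Literature.MathematicalPhysics.StatisticalMechanics (lennardJones IsMuGSC UniformlyDiscrete)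
open Literature.Geometry.DiscreteGeometry (EtaMatched ShellCloseTo fccKissingPattern hcpKissingPattern)
open Summit.AtomisticToContinuum.Crystallization.Theses.PalmUnimodularRigidity (MinimiserShells UnimodularEnergyLowerBound)
open Summit.AtomisticToContinuum.Crystallization.Theorems.MinimiserShells.Negative.LoadBearing
  (eStar meanRootEnergy GoodShell minimiserShells_iff)

/-- Euclidean 3-space (local notation). -/
local notation "E3" => EuclideanSpace ℝ (Fin 3)

/-- The shell window `{y ≠ 0, ‖y‖ ≤ 5/4}` (local notation). -/
local notation3 (prettyPrint := false) "𝕎" => ({y | y ≠ 0 ∧ ‖y‖ ≤ 5 / 4} : Set (EuclideanSpace ℝ (Fin 3)))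

/-! ## The shell predicate on counting measures and the window -/

/-- Unfolding `GoodShell` on a counting measure `count|S`: its atoms are the points of `S`. -/
theorem goodShell_count_restrict_iff (S : Set E3) :
    GoodShell ((Measure.count : Measure E3).restrict S) ↔
      ∃ a : ℝ, 9 / 10 ≤ a ∧ a ≤ 1 ∧ ∃ T : Finset E3,
        (↑T : Set E3) = {y : E3 | y ∈ S ∧ y ≠ 0 ∧ ‖y‖ ≤ 5 / 4 * a} ∧
          (ShellCloseTo (a / 100) T (Finset.image (fun v : E3 => a • v) fccKissingPattern) ∨
            ShellCloseTo (a / 100) T (Finset.image (fun v : E3 => a • v) hcpKissingPattern)) := by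
  unfold GoodShell
  simp only [count_restrict_singleton_ne_zero_iff]

/-- `GoodShell (count|S)` only looks at the window: `S` may be replaced by `𝕎 ∩ S`. -/
theorem goodShell_count_restrict_inter_window (S : Set E3) :
    GoodShell ((Measure.count : Measure E3).restrict (𝕎 ∩ S)) ↔ GoodShell ((Measure.count : Measure E3).restrict S) := by
  rw [goodShell_count_restrict_iff, goodShell_count_restrict_iff]
  refine exists_congr fun a => and_congr_right fun _ => and_congr_right fun ha => exists_congr fun T => ?_
  have h : {y : E3 | y ∈ 𝕎 ∩ S ∧ y ≠ 0 ∧ ‖y‖ ≤ 5 / 4 * a} = {y : E3 | y ∈ S ∧ y ≠ 0 ∧ ‖y‖ ≤ 5 / 4 * a} :=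
    Set.ext fun y => ⟨fun ⟨⟨_, hS⟩, hy0, hle⟩ => ⟨hS, hy0, hle⟩,
      fun ⟨hS, hy0, hle⟩ => ⟨⟨⟨hy0, by linarith⟩, hS⟩, hy0, hle⟩⟩
  rw [h]

/-- The window is measurable. -/
theorem measurableSet_window : MeasurableSet 𝕎 := by
  have h : 𝕎 = ({(0 : E3)} : Set E3)ᶜ ∩ Metric.closedBall (0 : E3) (5 / 4) := by
    ext y
    simp
  rw [h]
  exact (measurableSet_singleton _).compl.inter Metric.isClosed_closedBall.measurableSet

/-- Restriction to the window is a measurable map of configurations. -/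
theorem measurable_restrict_window : Measurable fun μ : Measure E3 => μ.restrict 𝕎 :=
  Measure.measurable_of_measurable_coe _ fun s hs => by
    simp only [Measure.restrict_apply hs]
    exact Measure.measurable_coe (hs.inter measurableSet_window)

/-- Tuples with all entries in the window form a measurable set. -/
theorem measurableSet_forall_mem_window (m : ℕ) : MeasurableSet {y : Fin m → E3 | ∀ i, y i ∈ 𝕎} := by
  have h : {y : Fin m → E3 | ∀ i, y i ∈ 𝕎} = ⋂ i, (fun y : Fin m → E3 => y i) ⁻¹' 𝕎 := by
    ext y
    simp
  rw [h]
  exact MeasurableSet.iInter fun i => measurable_pi_apply i measurableSet_window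

/-! ## Compactness of the isometries; projecting out a compact parameter -/

/-- The linear isometries of `ℝ³`, as continuous linear maps, form a compact set (closed and bounded
in a finite-dimensional space). -/
theorem isCompact_iso : IsCompact {L : E3 →L[ℝ] E3 | ∀ v, ‖L v‖ = ‖v‖} := by
  refine Metric.isCompact_of_isClosed_isBounded ?_ ?_
  · have h : {L : E3 →L[ℝ] E3 | ∀ v, ‖L v‖ = ‖v‖} = ⋂ v : E3, {L : E3 →L[ℝ] E3 | ‖L v‖ = ‖v‖} := by
      ext L
      simp
    rw [h]
    exact isClosed_iInter fun v => isClosed_eq (by fun_prop) continuous_const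
  · refine (Metric.isBounded_closedBall (x := (0 : E3 →L[ℝ] E3)) (r := 1)).subset fun L hL => ?_
    rw [Metric.mem_closedBall, dist_zero_right]
    exact ContinuousLinearMap.opNorm_le_bound _ zero_le_one fun v => by rw [hL v, one_mul]

/-- Projecting a closed relation along a compact set of parameters gives a closed set
(`isClosedMap_snd_of_compactSpace`). -/
theorem isClosed_setOf_exists_mem_of_isCompact {α β : Type*} [TopologicalSpace α] [TopologicalSpace β]
    {K : Set α} (hK : IsCompact K) {C : Set (α × β)} (hC : IsClosed C) :
    IsClosed {y : β | ∃ p ∈ K, (p, y) ∈ C} := by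
  haveI : CompactSpace ↥K := isCompact_iff_compactSpace.1 hK
  have hCc : IsClosed ((fun q : ↥K × β => ((q.1 : α), q.2)) ⁻¹' C) := hC.preimage (by fun_prop)
  have himg : {y : β | ∃ p ∈ K, (p, y) ∈ C} = Prod.snd '' ((fun q : ↥K × β => ((q.1 : α), q.2)) ⁻¹' C) := by
    ext y
    constructor
    · rintro ⟨p, hp, hc⟩
      exact ⟨(⟨p, hp⟩, y), hc, rfl⟩
    · rintro ⟨⟨⟨p, hp⟩, y'⟩, hc, rfl⟩
      exact ⟨p, hp, hc⟩
  rw [himg]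
  exact isClosedMap_snd_of_compactSpace _ hCc

/-! ## The matching relation and the closed sets of matched tuples -/

/-- The matching relation between parameters `(a, L)` and tuples `y` (pattern `pat`, assignment
`g : pat → Fin m`, gap `k`: every pattern point `v` is matched to the shell atom `y (g v)` —
`‖y (g v)‖ ≤ 5a/4`, `dist (y (g v)) (L (a • v)) ≤ a/100` — and every unmatched atom has norm
`≥ 5a/4 + 1/(k+1)`) is closed. -/
theorem isClosed_matchRel (m : ℕ) (pat : Finset E3) (g : ↥pat → Fin m) (k : ℕ) :
    IsClosed {r : (ℝ × (E3 →L[ℝ] E3)) × (Fin m → E3) |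
      (∀ v : ↥pat, ‖r.2 (g v)‖ ≤ 5 / 4 * r.1.1 ∧ dist (r.2 (g v)) (r.1.2 (r.1.1 • (v : E3))) ≤ r.1.1 / 100) ∧
        ∀ i : Fin m, i ∉ Set.range g → 5 / 4 * r.1.1 + 1 / ((k : ℝ) + 1) ≤ ‖r.2 i‖} := by
  simp only [Set.setOf_and, Set.setOf_forall]
  refine (isClosed_iInter fun v => (isClosed_le ?_ ?_).inter (isClosed_le ?_ ?_)).inter
    (isClosed_iInter fun i => isClosed_iInter fun _ => isClosed_le ?_ ?_)
  all_goals fun_prop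

/-- The set of tuples matched to `pat` through `g` with gap `k` for SOME scale `a ∈ [9/10, 1]` and
SOME isometry `L` is closed. -/
theorem isClosed_matchSet (m : ℕ) (pat : Finset E3) (g : ↥pat → Fin m) (k : ℕ) :
    IsClosed {y : Fin m → E3 | ∃ p ∈ Set.Icc (9 / 10 : ℝ) 1 ×ˢ {L : E3 →L[ℝ] E3 | ∀ v, ‖L v‖ = ‖v‖},
      (∀ v : ↥pat, ‖y (g v)‖ ≤ 5 / 4 * p.1 ∧ dist (y (g v)) (p.2 (p.1 • (v : E3))) ≤ p.1 / 100) ∧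
        ∀ i : Fin m, i ∉ Set.range g → 5 / 4 * p.1 + 1 / ((k : ℝ) + 1) ≤ ‖y i‖} :=
  isClosed_setOf_exists_mem_of_isCompact (isCompact_Icc.prod isCompact_iso) (isClosed_matchRel m pat g k)

/-! ## Matching ⇔ `ShellCloseTo` -/

/-- A matching given by two injective parametrisations of `T` and `Q` over the same index type,
pointwise `η`-close, is an `η`-matching `T ≃ Q`. -/
theorem etaMatched_of_param {ι : Type*} {η : ℝ} {T Q : Finset E3} {f₁ f₂ : ι → E3}
    (h₁ : ∀ v, f₁ v ∈ T) (h₁i : Function.Injective f₁) (h₁s : ∀ t ∈ T, ∃ v, f₁ v = t)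
    (h₂ : ∀ v, f₂ v ∈ Q) (h₂i : Function.Injective f₂) (h₂s : ∀ q ∈ Q, ∃ v, f₂ v = q)
    (hd : ∀ v, dist (f₁ v) (f₂ v) ≤ η) : EtaMatched η T Q := by
  have hb₁ : Function.Bijective (fun v => (⟨f₁ v, h₁ v⟩ : ↥T)) :=
    ⟨fun v w h => h₁i (congrArg Subtype.val h), fun t => by
      obtain ⟨v, hv⟩ := h₁s t t.2
      exact ⟨v, Subtype.ext hv⟩⟩
  have hb₂ : Function.Bijective (fun v => (⟨f₂ v, h₂ v⟩ : ↥Q)) :=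
    ⟨fun v w h => h₂i (congrArg Subtype.val h), fun q => by
      obtain ⟨v, hv⟩ := h₂s q q.2
      exact ⟨v, Subtype.ext hv⟩⟩
  refine ⟨(Equiv.ofBijective _ hb₁).symm.trans (Equiv.ofBijective _ hb₂), fun t => ?_⟩
  obtain ⟨v, rfl⟩ := (Equiv.ofBijective _ hb₁).surjective t
  rw [Equiv.trans_apply, Equiv.symm_apply_apply]
  exact hd v

/-- **Discretisation of `ShellCloseTo`.** For an injective tuple `y` of nonzero points and a scale
`a > 0`: the `5a/4`-shell of `range y` is `(a/100)`-close to the scaled pattern `a • pat` iff some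
injective assignment `g : pat → Fin m`, gap `k` and isometry `L` match. -/
theorem shell_iff_match {m : ℕ} {y : Fin m → E3} (hy : Function.Injective y) (h0 : ∀ i, y i ≠ 0)
    (pat : Finset E3) {a : ℝ} (ha0 : 0 < a) :
    (∃ T : Finset E3, (↑T : Set E3) = {z : E3 | z ∈ Set.range y ∧ z ≠ 0 ∧ ‖z‖ ≤ 5 / 4 * a} ∧
        ShellCloseTo (a / 100) T (Finset.image (fun v : E3 => a • v) pat)) ↔
      ∃ g : ↥pat → Fin m, Function.Injective g ∧ ∃ k : ℕ, ∃ L : E3 →L[ℝ] E3, (∀ v, ‖L v‖ = ‖v‖) ∧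
        (∀ v : ↥pat, ‖y (g v)‖ ≤ 5 / 4 * a ∧ dist (y (g v)) (L (a • (v : E3))) ≤ a / 100) ∧
          ∀ i : Fin m, i ∉ Set.range g → 5 / 4 * a + 1 / ((k : ℝ) + 1) ≤ ‖y i‖ := by
  classical
  constructor
  · rintro ⟨T, hT, A, e, he⟩
    have hmemT : ∀ z : E3, z ∈ T ↔ z ∈ Set.range y ∧ z ≠ 0 ∧ ‖z‖ ≤ 5 / 4 * a := by
      intro z
      rw [← Finset.mem_coe, hT]
      rfl
    -- index of a shell atom
    have hex : ∀ t : ↥T, ∃ i, y i = t := fun t => ((hmemT t).1 t.2).1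
    choose idx hidx using hex
    have idx_inj : Function.Injective idx := fun t t' h =>
      Subtype.ext (by rw [← hidx t, ← hidx t', h])
    -- the rotated and scaled pattern
    have hqmem : ∀ v : ↥pat, A (a • (v : E3)) ∈ Finset.image (⇑A) (Finset.image (fun v : E3 => a • v) pat) :=
      fun v => Finset.mem_image_of_mem _ (Finset.mem_image_of_mem _ v.2)
    set qv : ↥pat → ↥(Finset.image (⇑A) (Finset.image (fun v : E3 => a • v) pat)) :=
      fun v => ⟨A (a • (v : E3)), hqmem v⟩
    have qv_inj : Function.Injective qv := fun v w h =>
      Subtype.ext (smul_right_injective E3 ha0.ne' (A.injective (congrArg Subtype.val h)))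
    set g : ↥pat → Fin m := fun v => idx (e.symm (qv v))
    have hyg : ∀ v, y (g v) = (e.symm (qv v) : E3) := fun v => hidx _
    have g_inj : Function.Injective g := fun v w h => qv_inj (e.symm.injective (idx_inj h))
    -- every shell atom is matched
    have hcover : ∀ i, ‖y i‖ ≤ 5 / 4 * a → i ∈ Set.range g := by
      intro i hi
      have hiT : y i ∈ T := (hmemT _).2 ⟨⟨i, rfl⟩, h0 i, hi⟩
      obtain ⟨w, hw, hweq⟩ := Finset.mem_image.1 (e ⟨y i, hiT⟩).2
      obtain ⟨v, hv, rfl⟩ := Finset.mem_image.1 hw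
      refine ⟨⟨v, hv⟩, hy ?_⟩
      have hq : qv ⟨v, hv⟩ = e ⟨y i, hiT⟩ := Subtype.ext hweq
      rw [hyg, hq, Equiv.symm_apply_apply]
    -- the gap of the unmatched atoms
    have hk : ∀ i, ∃ k : ℕ, i ∉ Set.range g → 1 / ((k : ℝ) + 1) ≤ ‖y i‖ - 5 / 4 * a := by
      intro i
      by_cases hi : i ∈ Set.range g
      · exact ⟨0, fun h => absurd hi h⟩
      · have hgap : 5 / 4 * a < ‖y i‖ := lt_of_not_ge fun h => hi (hcover i h)
        obtain ⟨k, hk⟩ := exists_nat_one_div_lt (sub_pos.2 hgap)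
        exact ⟨k, fun _ => hk.le⟩
    choose kf hkf using hk
    refine ⟨g, g_inj, Finset.univ.sup kf, A.toContinuousLinearMap, fun v => A.norm_map v,
      fun v => ⟨?_, ?_⟩, fun i hi => ?_⟩
    · have hmem : y (g v) ∈ T := by
        rw [hyg]
        exact (e.symm (qv v)).2
      exact ((hmemT _).1 hmem).2.2
    · have hdist := he (e.symm (qv v))
      rw [Equiv.apply_symm_apply] at hdist
      rw [hyg]
      exact hdist
    · have h1 : 1 / (((Finset.univ.sup kf : ℕ) : ℝ) + 1) ≤ 1 / ((kf i : ℝ) + 1) := by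
        apply one_div_le_one_div_of_le (by positivity)
        have : (kf i : ℝ) ≤ ((Finset.univ.sup kf : ℕ) : ℝ) := by
          exact_mod_cast Finset.le_sup (f := kf) (Finset.mem_univ i)
        linarith
      linarith [hkf i hi]
  · rintro ⟨g, hg, k, L, hL, hc1, hc2⟩
    set A : E3 →ₗᵢ[ℝ] E3 := ⟨(L : E3 →ₗ[ℝ] E3), hL⟩
    have hAe : ∀ v : E3, A v = L v := fun v => rfl
    have hpos : (0 : ℝ) < 1 / ((k : ℝ) + 1) := by positivity
    refine ⟨Finset.univ.image fun v : ↥pat => y (g v), ?_, A, ?_⟩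
    · ext z
      simp only [Finset.coe_image, Finset.coe_univ, Set.image_univ, Set.mem_range, Set.mem_setOf_eq]
      constructor
      · rintro ⟨v, rfl⟩
        exact ⟨⟨g v, rfl⟩, h0 _, (hc1 v).1⟩
      · rintro ⟨⟨i, rfl⟩, -, hle⟩
        by_cases hi : i ∈ Set.range g
        · obtain ⟨v, rfl⟩ := hi
          exact ⟨v, rfl⟩
        · have := hc2 i hi
          linarith
    · refine etaMatched_of_param (ι := ↥pat) (f₁ := fun v => y (g v)) (f₂ := fun v => A (a • (v : E3)))
        (fun v => Finset.mem_image_of_mem _ (Finset.mem_univ v)) (hy.comp hg)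
        (fun t ht => by simpa using ht)
        (fun v => Finset.mem_image_of_mem _ (Finset.mem_image_of_mem _ v.2))
        (fun v w h => Subtype.ext (smul_right_injective E3 ha0.ne' (A.injective h)))
        (fun q hq => ?_) (fun v => by rw [hAe]; exact (hc1 v).2)
      obtain ⟨w, hw, rfl⟩ := Finset.mem_image.1 hq
      obtain ⟨v, hv, rfl⟩ := Finset.mem_image.1 hw
      exact ⟨⟨v, hv⟩, rfl⟩

/-! ## The Borel sets of good tuples -/

/-- **The shell condition (one pattern) on injective tuples of nonzero points is Borel**: it is
the countable union over `(g, k)` of the closed sets `isClosed_matchSet`. -/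
theorem exists_measurableSet_shellCloseTo (m : ℕ) (pat : Finset E3) :
    ∃ G : Set (Fin m → E3), MeasurableSet G ∧ ∀ y : Fin m → E3, Function.Injective y → (∀ i, y i ≠ 0) →
      ((∃ a : ℝ, 9 / 10 ≤ a ∧ a ≤ 1 ∧ ∃ T : Finset E3,
          (↑T : Set E3) = {z : E3 | z ∈ Set.range y ∧ z ≠ 0 ∧ ‖z‖ ≤ 5 / 4 * a} ∧
            ShellCloseTo (a / 100) T (Finset.image (fun v : E3 => a • v) pat)) ↔ y ∈ G) := by
  refine ⟨⋃ g : ↥pat → Fin m, ⋃ (_ : Function.Injective g), ⋃ k : ℕ,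
      {y : Fin m → E3 | ∃ p ∈ Set.Icc (9 / 10 : ℝ) 1 ×ˢ {L : E3 →L[ℝ] E3 | ∀ v, ‖L v‖ = ‖v‖},
        (∀ v : ↥pat, ‖y (g v)‖ ≤ 5 / 4 * p.1 ∧ dist (y (g v)) (p.2 (p.1 • (v : E3))) ≤ p.1 / 100) ∧
          ∀ i : Fin m, i ∉ Set.range g → 5 / 4 * p.1 + 1 / ((k : ℝ) + 1) ≤ ‖y i‖},
    MeasurableSet.iUnion fun g => MeasurableSet.iUnion fun _ => MeasurableSet.iUnion fun k =>
      (isClosed_matchSet m pat g k).measurableSet, fun y hy h0 => ?_⟩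
  simp only [Set.mem_iUnion, Set.mem_setOf_eq, Set.mem_prod, Set.mem_Icc, exists_prop, Prod.exists]
  constructor
  · rintro ⟨a, ha1, ha2, hT⟩
    obtain ⟨g, hg, k, L, hL, hc⟩ := (shell_iff_match hy h0 pat (by linarith)).1 hT
    exact ⟨g, hg, k, a, L, ⟨⟨ha1, ha2⟩, hL⟩, hc⟩
  · rintro ⟨g, hg, k, a, L, ⟨⟨ha1, ha2⟩, hL⟩, hc⟩
    exact ⟨a, ha1, ha2, (shell_iff_match hy h0 pat (by linarith)).2 ⟨g, hg, k, L, hL, hc⟩⟩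

/-- **The good-shell condition on injective tuples of nonzero points is Borel** (FCC or HCP). -/
theorem exists_measurableSet_goodShell (m : ℕ) :
    ∃ G : Set (Fin m → E3), MeasurableSet G ∧ ∀ y : Fin m → E3, Function.Injective y → (∀ i, y i ≠ 0) →
      (GoodShell ((Measure.count : Measure E3).restrict (Set.range y)) ↔ y ∈ G) := by
  obtain ⟨G₁, hG₁, h₁⟩ := exists_measurableSet_shellCloseTo m fccKissingPattern
  obtain ⟨G₂, hG₂, h₂⟩ := exists_measurableSet_shellCloseTo m hcpKissingPattern
  refine ⟨G₁ ∪ G₂, hG₁.union hG₂, fun y hy h0 => ?_⟩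
  rw [goodShell_count_restrict_iff, Set.mem_union, ← h₁ y hy h0, ← h₂ y hy h0]
  constructor
  · rintro ⟨a, ha1, ha2, T, hT, h | h⟩
    · exact Or.inl ⟨a, ha1, ha2, T, hT, h⟩
    · exact Or.inr ⟨a, ha1, ha2, T, hT, h⟩
  · rintro (⟨a, ha1, ha2, T, hT, h⟩ | ⟨a, ha1, ha2, T, hT, h⟩)
    · exact ⟨a, ha1, ha2, T, hT, Or.inl h⟩
    · exact ⟨a, ha1, ha2, T, hT, Or.inr h⟩

/-! ## The stub -/

/-- **stub_goodShellMeasurable** (S5 of line `equilibrium-in-law-surgery`, crux `MinimiserShells`):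
the shell event is Giry-measurable modulo the hard-core class — some measurable set of
configurations agrees with `GoodShell` on every rooted hard-core counting measure (for every
hard-core radius `δ > 0`).  The set is the preimage under `μ ↦ μ|𝕎` of the measurable set of
finite configurations provided by the transfer theorem for the property
`Q F := F ⊆ 𝕎 ∧ GoodShell (count|F)`. -/
theorem stub_goodShellMeasurable :
    ∃ B : Set (Measure (EuclideanSpace ℝ (Fin 3))), MeasurableSet B ∧
      ∀ δ : ℝ, 0 < δ → ∀ μ : Measure (EuclideanSpace ℝ (Fin 3)), IsRootedHardCore δ μ → (μ ∈ B ↔ GoodShell μ) := by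
  have hQ : ∀ m : ℕ, ∃ G : Set (Fin m → E3), MeasurableSet G ∧ ∀ y : Fin m → E3, Function.Injective y →
      ((Set.range y ⊆ 𝕎 ∧ GoodShell ((Measure.count : Measure E3).restrict (Set.range y))) ↔ y ∈ G) := by
    intro m
    obtain ⟨G, hGm, hG⟩ := exists_measurableSet_goodShell m
    refine ⟨{y : Fin m → E3 | ∀ i, y i ∈ 𝕎} ∩ G, (measurableSet_forall_mem_window m).inter hGm, fun y hy => ?_⟩
    rw [Set.range_subset_iff, Set.mem_inter_iff, Set.mem_setOf_eq]
    exact ⟨fun ⟨hW, hg⟩ => ⟨hW, (hG y hy fun i => (hW i).1).1 hg⟩,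
      fun ⟨hW, hg⟩ => ⟨hW, (hG y hy fun i => (hW i).1).2 hg⟩⟩
  obtain ⟨B, hB, hiff⟩ := exists_measurableSet_count_restrict_mem_iff
    (Q := fun F : Set E3 => F ⊆ 𝕎 ∧ GoodShell ((Measure.count : Measure E3).restrict F)) hQ
  refine ⟨(fun μ : Measure E3 => μ.restrict 𝕎) ⁻¹' B, measurable_restrict_window hB, fun δ hδ μ hμ => ?_⟩
  obtain ⟨S, -, hsep, rfl⟩ := hμ
  have hfin : (𝕎 ∩ S).Finite := by
    refine ((UniformlyDiscrete.finite_inter_closedBall ⟨δ, hδ, hsep⟩ 0 (5 / 4)).subset fun y hy => ⟨hy.2, ?_⟩)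
    rw [Metric.mem_closedBall, dist_zero_right]
    exact hy.1.2
  rw [Set.mem_preimage, Measure.restrict_restrict measurableSet_window, hiff _ hfin,
    goodShell_count_restrict_inter_window]
  exact ⟨fun h => h.2, fun h => ⟨Set.inter_subset_left, h⟩⟩

end Summit.AtomisticToContinuum.Crystallization.Theorems.PalmUnimodularRigidityMinimiserShells.GoodShellMeasurable

end
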